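import Summits.NavierStokesRegularity.FluidComputer.BlockPairTransit

/-!
# Block design — the damped pair field HANDS OFF when the damping is small
(bp3 gen 36, ASSEMBLY §2g.9(s): the sufficiency side of the (β″₁) question, EXACT ORBIT ONLY)

HONEST FRAMING: low prior, high value-of-information experiment on Tao's machine paradigm; NOT a
claim that NS blows up. Design level only: elementary real analysis of the planar polynomial field
`pairVF Λ₁ Λ₂ η k 0` of `BlockPairStall` (backscatter-free member `k' = 0`, `BlockPairSupport`).
Nothing here is a statement about Navier–Stokes, and nothing here is a reach CERTIFICATE:
pseudo-orbits, tubes and working regions are not treated — only the exact orbit from a clean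
input (the fences are those of `BlockPairTransit`).

WHAT IS PROVED. For `1/2 ≤ η ≤ 3/4`, forward exchange `k ≥ 6`, viscous damping
`0 ≤ Λ₁, Λ₂ ≤ 1/20` (block units: one tick = rescaled time `1`) and ANY clean input `(A₀, 0)`
with `A₀ ≥ 29/20` (the lower edge `aLo - δ` of the lane's input window, `Params.reg`), every
exact orbit `z` of `pairVF Λ₁ Λ₂ η k 0` on `[0, 1]` has `|a(1)| ≤ 1/4` and `b(1) ≥ 3/2`
(`pair_orbit_handoff`), i.e. `z 1 ∈ AoutO (Params.reg)` (`pair_orbit_mem_AoutO`): the damped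
gate hands the amplitude to the next mode within the tick. With `BlockPairCeiling`
(`nsVF_orbit_snd_lt_of_subcritical`: from `(A₀, 0)` the output stays below `A₀` once
`k A₀ ≤ Λ₂`, so the admissible input `(aLo, 0)`, `aLo = 3/2`, is then NOT handed off) this
gives two kernel-checked bounds, far apart, on the exact orbit's hand-off threshold in the
output damping: hand-off for `Λ₂ ≤ 1/20` (and `Λ₁ ≤ 1/20`), none for `Λ₂ ≥ k aLo`. The lane's
indicative numerics (`g36/numerics/transit36.py`, floating point, NOT certified) put the true
threshold near `Λ₂ ≈ 0.84–1.0` (`η = 1/2`, `A₀ ↘ 29/20`, `k = 6`); closing the gap is not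
attempted here.

PROOF (`x := η k A₀ ≥ 87/20`). By the clock of `BlockPairTransit` the output reaches `A₀/2`
by `1/x` and then stays above `0.45 A₀`, so the input decays at rate `0.4 x`: `6/(5x)` later
(`pair_switch`, `e^{-0.48} ≤ 20/31`) it is below `0.65 A₀`; from then on the energy floor
forces `η b² ≥ (7/16) A₀²` (`pair_after_switch`) and the input decays at rate
`r = √(3η/8) k A₀` until `t = 1`: `a(1) ≤ 0.65 A₀ e^{-(r - 2.2 r/x)} ≤ 1/4`
(`handoff_numerics`, `Real.quadratic_le_exp_of_nonneg`). Finally `η b(1)² ≥ (7/8) A₀² - 1/16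
≥ (9/4) η` gives `b(1) ≥ 3/2`; `η ≤ 3/4` enters only the clock and this last step. [folklore]
-/

open Set Filter Topology

namespace Summit.NavierStokesRegularity.FluidComputer

open Literature.Analysis.FluidPDE Literature.Analysis.FluidPDE.FluidComputer

namespace BlockDesign

section Handoff

variable {Λ₁ Λ₂ η k : ℝ} {z : ℝ → ℝ × ℝ}

/-- **THE SWITCH TIME.** Under the hypotheses of the clock: at `t₁ := t_A + 6/(5x) ≤ 11/(5x)`
the input is below `0.65 A₀` (`b ≥ 0.45 A₀` after `t_A`, so `a` decays at rate `0.4 x`, and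
`e^{-0.48} ≤ 20/31`). [folklore] -/
theorem pair_switch (hη : 1 / 2 ≤ η) (hη2 : η ≤ 3 / 4) (hk : 6 ≤ k)
    (hΛ₁ : 0 ≤ Λ₁) (hΛ₂ : 0 ≤ Λ₂) (hΛ₁' : Λ₁ ≤ 1 / 20) (hΛ₂' : Λ₂ ≤ 1 / 20)
    (hcont : ContinuousOn z (Icc 0 1))
    (hderiv : ∀ t ∈ Ico (0:ℝ) 1, HasDerivWithinAt z (pairVF Λ₁ Λ₂ η k 0 (z t)) (Ici t) t)
    {A₀ : ℝ} (hA₀ : 29 / 20 ≤ A₀) (hz0 : z 0 = (A₀, 0)) :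
    ∃ t₁ ∈ Icc (0:ℝ) 1, t₁ ≤ 11 / 5 * (1 / (η * k * A₀)) ∧ (z t₁).1 ≤ 13 / 20 * A₀ := by
  have hη0 : 0 < η := by linarith
  have hk0 : 0 < k := by linarith
  have hA : 0 < A₀ := by linarith
  have h0 : 0 < (z 0).1 := by rw [hz0]; exact hA
  have h0' : (z 0).2 = 0 := by rw [hz0]
  have hz01 : (z 0).1 = A₀ := by rw [hz0]
  have hx : 87 / 20 ≤ η * k * A₀ := by
    have h1 : (1 / 2 : ℝ) * 6 ≤ η * k := mul_le_mul hη hk (by norm_num) hη0.le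
    have h2 := mul_le_mul h1 hA₀ (by norm_num) (mul_nonneg hη0.le hk0.le)
    linarith
  set x : ℝ := η * k * A₀ with hxdef
  have hxpos : 0 < x := by linarith
  set τ : ℝ := 1 / x with hτ
  have hxτ : x * τ = 1 := by rw [hτ]; field_simp
  have hτpos : 0 < τ := by positivity
  have hτle : τ ≤ 20 / 87 := by rw [hτ, div_le_iff₀ hxpos]; linarith
  have basic := pair_orbit_basic hΛ₁ hΛ₂ hη0.le hk0 hcont hderiv h0 h0'
  obtain ⟨tA, htA, hbA⟩ :=
    pair_snd_reaches_half hη hη2 hk hΛ₁ hΛ₂ hΛ₁' hΛ₂' hcont hderiv hA₀ hz0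
  have htAτ : tA ≤ τ := htA.2
  have htAI : tA ∈ Icc (0:ℝ) 1 := ⟨htA.1, by linarith⟩
  have hbup := pair_snd_ge_after hΛ₂' hk0.le hcont hderiv hA htAI hbA
  have hrate : ∀ t ∈ Icc tA 1, 2 / 5 * x < η * k * (z t).2 := fun t ht => by
    have h := mul_le_mul_of_nonneg_left (hbup t ht) (mul_nonneg hη0.le hk0.le)
    rw [hxdef]; nlinarith [mul_pos (mul_pos hη0 hk0) hA, h]
  have hdec := pair_fst_decay hΛ₁ hcont hderiv htAI hrate
    (fun t ht => (basic t ⟨htA.1.trans ht.1, ht.2⟩).1)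
  have ht₁le : tA + 6 / 5 * τ ≤ 1 := by linarith
  refine ⟨tA + 6 / 5 * τ, ⟨by linarith [htA.1], ht₁le⟩, by linarith, ?_⟩
  have h := hdec (tA + 6 / 5 * τ) ⟨by linarith, ht₁le⟩
  have harg : 2 / 5 * x * (tA + 6 / 5 * τ - tA) = 12 / 25 := by
    linear_combination (12 / 25) * hxτ
  rw [harg] at h
  have hexp : Real.exp (-(12 / 25 : ℝ)) ≤ 20 / 31 := by
    have hq := Real.quadratic_le_exp_of_nonneg (show (0:ℝ) ≤ 12 / 25 by norm_num)
    rw [Real.exp_neg, inv_le_comm₀ (Real.exp_pos _) (by norm_num)]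
    norm_num at hq ⊢
    linarith
  have haA : (z tA).1 ≤ A₀ := hz01 ▸ (basic tA htAI).2.1
  calc (z (tA + 6 / 5 * τ)).1 ≤ (z tA).1 * Real.exp (-(12 / 25 : ℝ)) := h
    _ ≤ A₀ * (20 / 31) := mul_le_mul haA hexp (Real.exp_pos _).le hA.le
    _ ≤ 13 / 20 * A₀ := by linarith

/-- **AFTER THE SWITCH.** If `a(t₁) ≤ 0.65 A₀` then on `[t₁, 1]`: `a ≤ 0.65 A₀` (the input is
non-increasing) and `η b² ≥ (7/16) A₀²` (energy floor). [folklore] -/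
theorem pair_after_switch (hΛ₁ : 0 ≤ Λ₁) (hΛ₂ : 0 ≤ Λ₂) (hΛ₁' : Λ₁ ≤ 1 / 20)
    (hΛ₂' : Λ₂ ≤ 1 / 20) (hη : 0 ≤ η) (hk : 0 < k) (hcont : ContinuousOn z (Icc 0 1))
    (hderiv : ∀ t ∈ Ico (0:ℝ) 1, HasDerivWithinAt z (pairVF Λ₁ Λ₂ η k 0 (z t)) (Ici t) t)
    {A₀ t₁ : ℝ} (hA : 0 < A₀) (hz0 : z 0 = (A₀, 0)) (ht₁ : t₁ ∈ Icc (0:ℝ) 1)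
    (ha₁ : (z t₁).1 ≤ 13 / 20 * A₀) :
    ∀ t ∈ Icc t₁ 1, (z t).1 ≤ 13 / 20 * A₀ ∧ 7 / 16 * A₀ ^ 2 ≤ η * (z t).2 ^ 2 := by
  have h0 : 0 < (z 0).1 := by rw [hz0]; exact hA
  have h0' : (z 0).2 = 0 := by rw [hz0]
  have hz01 : (z 0).1 = A₀ := by rw [hz0]
  have basic := pair_orbit_basic hΛ₁ hΛ₂ hη hk hcont hderiv h0 h0'
  have hfloor := pair_energy_ge hΛ₁ hΛ₂ hΛ₁' hΛ₂' hη hk hcont hderiv h0 h0'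
  have hcont₁ : ContinuousOn z (Icc t₁ 1) := hcont.mono (Icc_subset_Icc_left ht₁.1)
  have hderiv₁ : ∀ t ∈ Ico t₁ 1, HasDerivWithinAt z (pairVF Λ₁ Λ₂ η k 0 (z t)) (Ici t) t :=
    fun t ht => hderiv t ⟨ht₁.1.trans ht.1, ht.2⟩
  intro t ht
  have htI : t ∈ Icc (0:ℝ) 1 := ⟨ht₁.1.trans ht.1, ht.2⟩
  have hmono : (z t).1 ≤ (z t₁).1 :=
    image_le_of_deriv_right_le_deriv_boundary (f := fun t => (z t).1) hcont₁.fst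
      (fun s hs => hasDerivWithinAt_fst_comp (hderiv₁ s hs)) (B := fun _ => (z t₁).1)
      (B' := fun _ => 0) le_rfl continuousOn_const (fun _ _ => hasDerivWithinAt_const _ _ _)
      (fun s hs => by
        have hb := basic s ⟨ht₁.1.trans hs.1, hs.2.le⟩
        show (pairVF Λ₁ Λ₂ η k 0 (z s)).1 ≤ 0
        rw [pairVF_zero_fst]
        have h1 := mul_nonneg hΛ₁ hb.1.le
        have h2 := mul_nonneg (mul_nonneg (mul_nonneg hη hk.le) hb.1.le) hb.2.2.1
        linarith)
      ht
  have ha : (z t).1 ≤ 13 / 20 * A₀ := hmono.trans ha₁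
  refine ⟨ha, ?_⟩
  have hf := hfloor t htI
  rw [hz01] at hf
  have hasq : (z t).1 ^ 2 ≤ (13 / 20 * A₀) ^ 2 := pow_le_pow_left₀ (basic t htI).1.le ha 2
  nlinarith [hf, hasq, mul_le_mul_of_nonneg_left ht.2 (sq_nonneg A₀), sq_nonneg A₀]

/-- Numerical bounds on `√(3η/8)` for `η ≥ 1/2`. [folklore] -/
theorem sqrt_three_eighths_bounds (hη : 1 / 2 ≤ η) :
    433 / 1000 ≤ Real.sqrt (3 * η / 8) ∧ Real.sqrt (3 * η / 8) ≤ 13 / 15 * η ∧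
      Real.sqrt (3 * η / 8) ^ 2 = 3 * η / 8 := by
  refine ⟨?_, ?_, Real.sq_sqrt (by linarith)⟩
  · calc (433 / 1000 : ℝ) = Real.sqrt ((433 / 1000) ^ 2) := (Real.sqrt_sq (by norm_num)).symm
      _ ≤ Real.sqrt (3 * η / 8) := Real.sqrt_le_sqrt (by nlinarith [hη])
  · have h := mul_le_mul_of_nonneg_left hη (by linarith : (0:ℝ) ≤ η)
    calc Real.sqrt (3 * η / 8) ≤ Real.sqrt ((13 / 15 * η) ^ 2) :=
          Real.sqrt_le_sqrt (by nlinarith [h])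
      _ = 13 / 15 * η := Real.sqrt_sq (by linarith)

/-- The closing numerical inequality: `0.65 A₀ e^{-y} ≤ 1/4` once `y ≥ 2.598 A₀ - 143/75`,
`A₀ ≥ 29/20` (via `1 + y + y²/2 ≤ e^y`). [folklore] -/
theorem handoff_numerics {A₀ y : ℝ} (hA₀ : 29 / 20 ≤ A₀)
    (hy : 2598 / 1000 * A₀ - 143 / 75 ≤ y) : 13 / 20 * A₀ * Real.exp (-y) ≤ 1 / 4 := by
  have hy0 : 0 ≤ y := by linarith
  have hq := Real.quadratic_le_exp_of_nonneg hy0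
  have hqpos : 0 < 1 + y + y ^ 2 / 2 := by positivity
  have hexp : Real.exp (-y) ≤ 1 / (1 + y + y ^ 2 / 2) := by
    rw [Real.exp_neg, one_div]; exact inv_anti₀ hqpos hq
  have hpoly : 13 / 5 * A₀ ≤ 1 + y + y ^ 2 / 2 := by
    have h1 := mul_nonneg (sub_nonneg.2 hy)
      (by linarith : (0:ℝ) ≤ y + (2598 / 1000 * A₀ - 143 / 75))
    nlinarith [h1, hy, hA₀, sq_nonneg (A₀ - 29 / 20)]
  calc 13 / 20 * A₀ * Real.exp (-y) ≤ 13 / 20 * A₀ * (1 / (1 + y + y ^ 2 / 2)) :=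
        mul_le_mul_of_nonneg_left hexp (by linarith)
    _ ≤ 1 / 4 := by rw [mul_one_div, div_le_iff₀ hqpos]; linarith

/-- **THE DAMPED GATE HANDS OFF (exact orbit).** `1/2 ≤ η ≤ 3/4`, `k ≥ 6`, `0 ≤ Λ₁, Λ₂ ≤ 1/20`,
an exact orbit of `pairVF Λ₁ Λ₂ η k 0` on `[0, 1]` from `(A₀, 0)` with `A₀ ≥ 29/20`:
`|a(1)| ≤ 1/4` and `b(1) ≥ 3/2`. [folklore] -/
theorem pair_orbit_handoff (hη : 1 / 2 ≤ η) (hη2 : η ≤ 3 / 4) (hk : 6 ≤ k)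
    (hΛ₁ : 0 ≤ Λ₁) (hΛ₂ : 0 ≤ Λ₂) (hΛ₁' : Λ₁ ≤ 1 / 20) (hΛ₂' : Λ₂ ≤ 1 / 20)
    (hcont : ContinuousOn z (Icc 0 1))
    (hderiv : ∀ t ∈ Ico (0:ℝ) 1, HasDerivWithinAt z (pairVF Λ₁ Λ₂ η k 0 (z t)) (Ici t) t)
    {A₀ : ℝ} (hA₀ : 29 / 20 ≤ A₀) (hz0 : z 0 = (A₀, 0)) :
    |(z 1).1| ≤ 1 / 4 ∧ 3 / 2 ≤ (z 1).2 := by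
  have hη0 : 0 < η := by linarith
  have hk0 : 0 < k := by linarith
  have hA : 0 < A₀ := by linarith
  have h0 : 0 < (z 0).1 := by rw [hz0]; exact hA
  have h0' : (z 0).2 = 0 := by rw [hz0]
  have hz01 : (z 0).1 = A₀ := by rw [hz0]
  have basic := pair_orbit_basic hΛ₁ hΛ₂ hη0.le hk0 hcont hderiv h0 h0'
  set τ : ℝ := 1 / (η * k * A₀) with hτ
  have hxτ : η * k * A₀ * τ = 1 := by rw [hτ]; field_simp
  have hτpos : 0 < τ := by positivity
  obtain ⟨t₁, ht₁I, ht₁τ, ha₁⟩ :=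
    pair_switch hη hη2 hk hΛ₁ hΛ₂ hΛ₁' hΛ₂' hcont hderiv hA₀ hz0
  have after := pair_after_switch hΛ₁ hΛ₂ hΛ₁' hΛ₂' hη0.le hk0 hcont hderiv hA hz0 ht₁I ha₁
  obtain ⟨hs_lo, hs_hi, hsq⟩ := sqrt_three_eighths_bounds hη
  -- the late decay rate `r = √(3η/8) k A₀ < η k b` on `[t₁, 1]`
  set r : ℝ := Real.sqrt (3 * η / 8) * k * A₀ with hr
  have hr0 : 0 ≤ r := by positivity
  have hrate : ∀ t ∈ Icc t₁ 1, r < η * k * (z t).2 := fun t ht => by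
    have h1 : r ^ 2 < (η * k * (z t).2) ^ 2 := by
      have e1 : r ^ 2 = 3 * η / 8 * (k ^ 2 * A₀ ^ 2) := by rw [hr, mul_pow, mul_pow, hsq]; ring
      have e2 : (η * k * (z t).2) ^ 2 = k ^ 2 * (η * (η * (z t).2 ^ 2)) := by ring
      rw [e1, e2]
      have h3 := mul_le_mul_of_nonneg_left (after t ht).2 hη0.le
      have h4 : 0 < k ^ 2 * A₀ ^ 2 := by positivity
      linarith [mul_le_mul_of_nonneg_left h3 (sq_nonneg k), mul_pos hη0 h4]
    exact lt_of_pow_lt_pow_left₀ 2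
      (mul_nonneg (mul_nonneg hη0.le hk0.le) (basic t ⟨ht₁I.1.trans ht.1, ht.2⟩).2.2.1) h1
  have hdec := pair_fst_decay hΛ₁ hcont hderiv ht₁I hrate
    (fun t ht => (basic t ⟨ht₁I.1.trans ht.1, ht.2⟩).1) 1 ⟨ht₁I.2, le_rfl⟩
  -- the exponent `r (1 - t₁) ≥ 2.598 A₀ - 143/75`
  have hy : 2598 / 1000 * A₀ - 143 / 75 ≤ r * (1 - t₁) := by
    have hr_lo : 2598 / 1000 * A₀ ≤ r := by
      have h1 : 433 / 1000 * 6 ≤ Real.sqrt (3 * η / 8) * k :=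
        mul_le_mul hs_lo hk (by norm_num) (Real.sqrt_nonneg _)
      have h2 := mul_le_mul_of_nonneg_right h1 hA.le
      rw [hr]; linarith
    have h2 : r * τ * η = Real.sqrt (3 * η / 8) := by
      rw [hr]; linear_combination (Real.sqrt (3 * η / 8)) * hxτ
    have h3 : r * τ ≤ 13 / 15 := le_of_mul_le_mul_right (by rw [h2]; exact hs_hi) hη0
    have h4 : r * t₁ ≤ r * (11 / 5 * τ) := mul_le_mul_of_nonneg_left ht₁τ hr0
    linarith [hr_lo, h3, h4]
  have ha_one : (z 1).1 ≤ 1 / 4 :=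
    calc (z 1).1 ≤ (z t₁).1 * Real.exp (-(r * (1 - t₁))) := hdec
      _ ≤ 13 / 20 * A₀ * Real.exp (-(r * (1 - t₁))) :=
          mul_le_mul_of_nonneg_right ha₁ (Real.exp_pos _).le
      _ ≤ 1 / 4 := handoff_numerics hA₀ hy
  have hb1 := basic 1 ⟨zero_le_one, le_rfl⟩
  refine ⟨abs_le.2 ⟨by linarith [hb1.1], ha_one⟩, ?_⟩
  -- `b(1) ≥ 3/2` from the energy floor
  have hfl := pair_energy_ge hΛ₁ hΛ₂ hΛ₁' hΛ₂' hη0.le hk0 hcont hderiv h0 h0' 1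
    ⟨zero_le_one, le_rfl⟩
  rw [hz01] at hfl
  have hasq : (z 1).1 ^ 2 ≤ (1 / 4) ^ 2 := pow_le_pow_left₀ hb1.1.le ha_one 2
  have hA2 : (29 / 20 : ℝ) ^ 2 ≤ A₀ ^ 2 := pow_le_pow_left₀ (by norm_num) hA₀ 2
  have hηb : 7 / 8 * (29 / 20) ^ 2 - 1 / 16 ≤ η * (z 1).2 ^ 2 := by linarith [hfl, hasq, hA2]
  have hη94 := mul_le_mul_of_nonneg_right hη2 (by norm_num : (0:ℝ) ≤ 9 / 4)
  have hb2 : (3 / 2 : ℝ) ^ 2 ≤ (z 1).2 ^ 2 :=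
    le_of_mul_le_mul_left (by norm_num at hηb ⊢; linarith [hηb, hη94]) hη0
  exact (pow_le_pow_iff_left₀ (by norm_num) hb1.2.2.1 two_ne_zero).1 hb2

end Handoff

/-- **COROLLARY (the lane's windows).** Under the hypotheses of `pair_orbit_handoff`, with
`η = S.eta ∈ [1/2, 3/4]`: `z 1 ∈ AoutO (Params.reg S _ _)` (`|a| ≤ σsp = 1/4`, `b ≥ aLo = 3/2`).
The clean input `(A₀, 0)`, `A₀ ≥ 29/20 = aLo - δ`, is any point of the input axis of `AinO`.
NOT a reach certificate (exact orbit only). [folklore] -/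
theorem pair_orbit_mem_AoutO {S : CascadeSpecs} (hS : S.lam0 = 1) (hη : 1 / 2 ≤ S.eta)
    (hη2 : S.eta ≤ 3 / 4) {k Λ₁ Λ₂ : ℝ} (hk : 6 ≤ k)
    (hΛ₁ : 0 ≤ Λ₁) (hΛ₂ : 0 ≤ Λ₂) (hΛ₁' : Λ₁ ≤ 1 / 20) (hΛ₂' : Λ₂ ≤ 1 / 20)
    {z : ℝ → ℝ × ℝ} (hcont : ContinuousOn z (Icc 0 1))
    (hderiv : ∀ t ∈ Ico (0:ℝ) 1, HasDerivWithinAt z (pairVF Λ₁ Λ₂ S.eta k 0 (z t)) (Ici t) t)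
    {A₀ : ℝ} (hA₀ : 29 / 20 ≤ A₀) (hz0 : z 0 = (A₀, 0)) :
    z 1 ∈ AoutO (Params.reg S hS hη) := by
  obtain ⟨ha, hb⟩ := pair_orbit_handoff hη hη2 hk hΛ₁ hΛ₂ hΛ₁' hΛ₂' hcont hderiv hA₀ hz0
  simp only [AoutO, Params.reg, Set.mem_prod, Set.mem_Icc, Set.mem_Ici]
  exact ⟨⟨by linarith only [(abs_le.1 ha).1], (abs_le.1 ha).2⟩, hb⟩

end BlockDesign

end Summit.NavierStokesRegularity.FluidComputer
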